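import Summits.BirchSwinnertonDyer.BirchSwinnertonDyer.Theorems.PrintX10bReadoutIndexOfLocalClauses
import Summits.BirchSwinnertonDyer.BirchSwinnertonDyer.Theorems.PrintX10bStubReadoutLocalIndexBad
import Summits.BirchSwinnertonDyer.BirchSwinnertonDyer.Theorems.PrintX10bStubReadoutLocalOff
import Summits.BirchSwinnertonDyer.BirchSwinnertonDyer.Theorems.PrintX10bStubReadoutLocalIndexPClosed
import HarnessLib

/-!
# (B5) `stub_readoutIndex : Stmt.readoutIndex` (registered stub of skeleton v8; DERIVED in v9) of the shared μ-crux CLOSED from the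
# three place-wise letters (helper for `MuInequalityCoherentPairOfPrintCG`, stmt-BirchSwinnertonDyer-23428; cell `pub/bsd-print-x9`,
# seat `bsd-line-x10b-p2` g8, (B5) owner)

Summits-side, THEOREMS ONLY; ROUTE-INDEPENDENT.  `stub_readoutIndex := readoutIndex_of_localClauses stub_readoutLocalOff
stub_readoutLocalIndexP stub_readoutLocalIndexBad` (x10b-p1-w2 g11's assembly p675427 over the (B5-OFF) closer p676384 of x9-p2 g6, the
(B5-P) closer p679487 of x10b-p1-w7 g3 over x10b-p1-w6 g4's hS′ p678180, and this seat's (B5-BAD) closer p676090): the DISCRETE half of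
`stub_controlGlue` — Howard Prop. 2.2.8, second map, at `𝔮 = T^m + p`, `m`-uniform — as ONE importable theorem (the `hB5` of the
REDUCTION-CERT `HeegnerMuPartOfPrintCG.muInequalityCoherentPairOfPrintCG_of_stubs`, p675097).  BSD is not proved by any of this; no summit
statement is proved by this seat.
-/

set_option linter.dupNamespace false
set_option autoImplicit false

noncomputable section

namespace Summit.BirchSwinnertonDyer.BirchSwinnertonDyer.Theorems.HeegnerMuPartControlGlue

/-- **(B5) `stub_readoutIndex : Stmt.readoutIndex` holds** — the `m`-uniform index bound `#(Sel_∞[ψ_m] ⧸ readout(H¹_{F_𝔮}(K, A_𝔮))) ≤ p^c`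
from the three place-wise letters (OFF: no contribution at good places and ∞; P: `≤ p^{2p^s}` at `v ∣ p`; BAD: `≤ p^{8p^e}` at `v ∣ N`). [cite: Howard2004HeegnerKolyvagin, Prop. 2.2.8 (second map) and proof of Thm. 2.2.10]
[cite: GreenbergLNM1716, Prop. 2.4 and §4 pp. 98, 104] -/
theorem stub_readoutIndex : Stmt.readoutIndex :=
  readoutIndex_of_localClauses stub_readoutLocalOff stub_readoutLocalIndexP stub_readoutLocalIndexBad

end Summit.BirchSwinnertonDyer.BirchSwinnertonDyer.Theorems.HeegnerMuPartControlGlue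

end
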